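import Summits.BirchSwinnertonDyer.Rank1Residual.Additive.GordAnomalousResidueThreeSix
import Summits.BirchSwinnertonDyer.Rank1Residual.Additive.GordRankOneIwasawaClasses
import HarnessLib

/-!
# X3♯(G-ord) / X4♯(G-ord) class theorems with the anomalous proviso REPLACED by one residue of
# Cremona's `c₄` / `c₆` (gen 36 parts 4–5 plugged into the gen 18/19 consumers)

HONEST FRAMING (cell `b2b-bsdres`, run/shared/lean/b2b/bsd-rank1-residual/, verbatim in every
file): the goal of the cell is to DELETE the COMBINATION-SHAPED residual classes of the
Birch–Swinnerton-Dyer formula for ALL analytic-rank `≤ 1` elliptic curves over `ℚ` — "full BSD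
formula for every rank `≤ 1` curve in class `C`" assembled STRICTLY from published theorems — so
that the rank-`≤ 1` remainder becomes exactly the CONSTRUCTION-SHAPED classes, which are TYPED
(missing-input `Prop`s), NOT attempted. This is not "finishing BSD". Sub-cell `additive-p2`
(X3♯(G-ord) / X4♯(G-ord)), generation 36, part 7: research route; no claim beyond the stated
classes; theorems only, no definition, no named fact, nothing booked, no label moved. The classes stay
CONSTRUCTION-SHAPED: every statement below is conditional on the SAME typed over-`ℚ_∞` inputs as its
gen 18/19 parent (`CycCharLeadingTermAt` = Delbourgo's MC (G) at `T = 0`; `RankOneIwasawaInputAt`);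
what changes is only that the proviso `Delbourgo2002.ReductionNonAnomalous W p` is now a DECIDED
residue of Cremona's invariants (parts 4–5), so the EXACT rows are named by an integer congruence.

## What is proved (`hDel` = Delbourgo 2002 (A)+(B), `hGZK`, `hmod` as in the parents; `E` non-CM)

* defect `4` at `p = 5` (Kodaira `III`, `III*`; `c₄(E) = n·(−5)^v`, `5 ∤ n`, **`n ≢ 1 (mod 5)`**):
  `ClassX4Gord.bsdp_rankZero_of_cycChar_of_not_modEq_five` (`r_an = 0`: MC equality at `T = 0` ⟹
  `BSD(E,5)`), `ClassX4Gord.bsdp_rankOne_of_iwasawaInput_of_not_modEq_five` (`r_an = 1`), and the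
  X3 twins — the 163/233 non-anomalous defect-`4` window rows at `5` by name (gen 19 covers `p ≥ 7`);
* defect `3`/`6` at any `p ≥ 5` (`c₆(E) = n·(−p)^v`, `p ∤ n`,
  **`C((p−1)/2,(p−1)/3)·(−n/864)^{(p−1)/6} ≠ 1` in `ZMod p`**): `ClassX4Gord.bsdp_rankZero_of_cycChar_of_c₆Residue`,
  `ClassX4Gord.bsdp_rankOne_of_iwasawaInput_of_c₆Residue`, X3 twins (gen 34 covers the non-capable
  `p` outright; this names the rows at the capable `p = 7, 19, 37, …`); at `p = 7`: **`n ≢ −1 (mod 7)`**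
  (`ClassX4Gord.bsdp_rankZero_of_cycChar_of_not_modEq_seven`, `…rankOne…`; 211/261 window rows).

References: D. Delbourgo, J. Number Theory 95 (2002) Theorems (A), (B), p. 39–40; parts 4–5 of this
generation.
-/

noncomputable section

open scoped Classical NumberField

open WeierstrassCurve NumberField Literature.NumberTheory.EllipticCurves
  Literature.NumberTheory.EllipticCurves.Rank1Residual
  Literature.NumberTheory.EllipticCurves.Rank1Residual.Typed

namespace Summit.BirchSwinnertonDyer.Rank1Residual.Additive

variable {W : WeierstrassCurve ℚ} {p : ℕ} [hp : Fact p.Prime] [W.IsElliptic] [W.IsGloballyMinimal]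

/-! ### Defect `4` at `p = 5`: the proviso is `c₄/(−5)^v ≢ 1 (mod 5)` -/

section Five

variable [h5 : Fact (Nat.Prime 5)]

/-- **X4♯(G-ord) ∩ {III, III*} at `p = 5`, `r_an = 0`, `E` non-CM, `c₄/(−5)^v ≢ 1 (mod 5)`: MC EQUALITY
at `T = 0` ⟹ `BSD(E,5)`** — exact (the anomalous proviso is this residue, part 4).
[cite: Delbourgo2002, Theorem (A), (B) (p. 40)] -/
theorem ClassX4Gord.bsdp_rankZero_of_cycChar_of_not_modEq_five (hDel : Delbourgo2002.mainTheorem)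
    (hGZK : rank_eq_analyticRank_of_analyticRank_le_one) (hmod : hasEntireLFunction_rat)
    (hX : ClassX4Gord W 5) (hcm : ¬ W.HasCM) (he : semistabilityIndex W 5 = 4) {n : ℤ} {v : ℕ}
    (hpn : ¬ (5 : ℤ) ∣ n) (hn : W.c₄ = n * (-(5 : ℚ)) ^ v) (hres : ¬ n ≡ 1 [ZMOD 5])
    (hr : W.analyticRank = 0) (hMC : CycCharLeadingTermAt W 5) : BSDp W 5 :=
  ClassX4Gord.bsdp_rankZero_of_cycChar_of_nonAnomalous hDel hGZK hmod hX hcm le_rfl hr hMC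
    ((reductionNonAnomalous_five_iff_of_semistabilityIndex_eq_four W hX.typeGOrd.typeG he hpn hn).mpr
      hres)

/-- **X4♯(G-ord) ∩ {III, III*} at `p = 5`, `r_an = 1`, `E` non-CM, `c₄/(−5)^v ≢ 1 (mod 5)`: the
Iwasawa-route residue ⟹ `BSD(E,5)`** — exact. [cite: Delbourgo2002, Theorem (A), (B) (p. 40)] -/
theorem ClassX4Gord.bsdp_rankOne_of_iwasawaInput_of_not_modEq_five (hDel : Delbourgo2002.mainTheorem)
    (hGZK : rank_eq_analyticRank_of_analyticRank_le_one) (hmod : hasEntireLFunction_rat)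
    (hX : ClassX4Gord W 5) (hcm : ¬ W.HasCM) (he : semistabilityIndex W 5 = 4) {n : ℤ} {v : ℕ}
    (hpn : ¬ (5 : ℤ) ∣ n) (hn : W.c₄ = n * (-(5 : ℚ)) ^ v) (hres : ¬ n ≡ 1 [ZMOD 5])
    (hr : W.analyticRank = 1) (hIn : RankOneIwasawaInputAt W 5) : BSDp W 5 :=
  ClassX4Gord.bsdp_rankOne_of_iwasawaInput_of_nonAnomalous hDel hGZK hmod hX hcm le_rfl hr hIn
    ((reductionNonAnomalous_five_iff_of_semistabilityIndex_eq_four W hX.typeGOrd.typeG he hpn hn).mpr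
      hres)

/-- **X3♯(G-ord) ∩ {III, III*} at `p = 5`, `r_an = 0`, `E` non-CM, `c₄/(−5)^v ≢ 1 (mod 5)`: MC EQUALITY
at `T = 0` ⟹ `BSD(E,5)`** — exact. [cite: Delbourgo2002, Theorem (A), (B) (p. 40)] -/
theorem ClassX3Gord.bsdp_rankZero_of_cycChar_of_not_modEq_five (hDel : Delbourgo2002.mainTheorem)
    (hGZK : rank_eq_analyticRank_of_analyticRank_le_one) (hmod : hasEntireLFunction_rat)
    (hX : ClassX3Gord W 5) (hcm : ¬ W.HasCM) (he : semistabilityIndex W 5 = 4) {n : ℤ} {v : ℕ}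
    (hpn : ¬ (5 : ℤ) ∣ n) (hn : W.c₄ = n * (-(5 : ℚ)) ^ v) (hres : ¬ n ≡ 1 [ZMOD 5])
    (hr : W.analyticRank = 0) (hMC : CycCharLeadingTermAt W 5) : BSDp W 5 :=
  ClassX3Gord.bsdp_rankZero_of_cycChar_of_nonAnomalous hDel hGZK hmod hX hcm le_rfl hr hMC
    ((reductionNonAnomalous_five_iff_of_semistabilityIndex_eq_four W hX.typeGOrd.typeG he hpn hn).mpr
      hres)

/-- **X3♯(G-ord) ∩ {III, III*} at `p = 5`, `r_an = 1`, `E` non-CM, `c₄/(−5)^v ≢ 1 (mod 5)`: the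
Iwasawa-route residue ⟹ `BSD(E,5)`** — exact. [cite: Delbourgo2002, Theorem (A), (B) (p. 40)] -/
theorem ClassX3Gord.bsdp_rankOne_of_iwasawaInput_of_not_modEq_five (hDel : Delbourgo2002.mainTheorem)
    (hGZK : rank_eq_analyticRank_of_analyticRank_le_one) (hmod : hasEntireLFunction_rat)
    (hX : ClassX3Gord W 5) (hcm : ¬ W.HasCM) (he : semistabilityIndex W 5 = 4) {n : ℤ} {v : ℕ}
    (hpn : ¬ (5 : ℤ) ∣ n) (hn : W.c₄ = n * (-(5 : ℚ)) ^ v) (hres : ¬ n ≡ 1 [ZMOD 5])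
    (hr : W.analyticRank = 1) (hIn : RankOneIwasawaInputAt W 5) : BSDp W 5 :=
  ClassX3Gord.bsdp_rankOne_of_iwasawaInput_of_nonAnomalous hDel hGZK hmod hX hcm le_rfl hr hIn
    ((reductionNonAnomalous_five_iff_of_semistabilityIndex_eq_four W hX.typeGOrd.typeG he hpn hn).mpr
      hres)

end Five

/-! ### Defect `3`/`6` at any `p ≥ 5`: the proviso is one sextic residue of `c₆/(−p)^v` -/

/-- **X4♯(G-ord) ∩ {II, IV, IV*, II*}, `p ≥ 5`, `r_an = 0`, `E` non-CM, residue
`C((p−1)/2,(p−1)/3)·(−n/864)^{(p−1)/6} ≠ 1` in `ZMod p` (`c₆ = n(−p)^v`): MC EQUALITY at `T = 0` ⟹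
`BSD(E,p)`** — exact (part 5; at non-capable `p` the residue condition is automatic, gen 34).
[cite: Delbourgo2002, Theorem (A), (B) (p. 40)] -/
theorem ClassX4Gord.bsdp_rankZero_of_cycChar_of_c₆Residue (hDel : Delbourgo2002.mainTheorem)
    (hGZK : rank_eq_analyticRank_of_analyticRank_le_one) (hmod : hasEntireLFunction_rat)
    (hX : ClassX4Gord W p) (hcm : ¬ W.HasCM) (hp5 : 5 ≤ p) (h3e : 3 ∣ semistabilityIndex W p)
    {n : ℤ} {v : ℕ} (hpn : ¬ (p : ℤ) ∣ n) (hn : W.c₆ = n * (-(p : ℚ)) ^ v)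
    (hres : ¬ ((((p - 1) / 2).choose ((p - 1) / 3) : ℕ) : ZMod p) *
      (-(n : ZMod p) / 864) ^ ((p - 1) / 6) = 1)
    (hr : W.analyticRank = 0) (hMC : CycCharLeadingTermAt W p) : BSDp W p :=
  ClassX4Gord.bsdp_rankZero_of_cycChar_of_nonAnomalous hDel hGZK hmod hX hcm hp5 hr hMC
    ((reductionNonAnomalous_iff_of_three_dvd_semistabilityIndex W p hp5 hX.typeGOrd.typeG h3e hpn
      hn).mpr hres)

/-- **X4♯(G-ord) ∩ {II, IV, IV*, II*}, `p ≥ 5`, `r_an = 1`, `E` non-CM, the same residue `≠ 1`: the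
Iwasawa-route residue ⟹ `BSD(E,p)`** — exact. [cite: Delbourgo2002, Theorem (A), (B) (p. 40)] -/
theorem ClassX4Gord.bsdp_rankOne_of_iwasawaInput_of_c₆Residue (hDel : Delbourgo2002.mainTheorem)
    (hGZK : rank_eq_analyticRank_of_analyticRank_le_one) (hmod : hasEntireLFunction_rat)
    (hX : ClassX4Gord W p) (hcm : ¬ W.HasCM) (hp5 : 5 ≤ p) (h3e : 3 ∣ semistabilityIndex W p)
    {n : ℤ} {v : ℕ} (hpn : ¬ (p : ℤ) ∣ n) (hn : W.c₆ = n * (-(p : ℚ)) ^ v)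
    (hres : ¬ ((((p - 1) / 2).choose ((p - 1) / 3) : ℕ) : ZMod p) *
      (-(n : ZMod p) / 864) ^ ((p - 1) / 6) = 1)
    (hr : W.analyticRank = 1) (hIn : RankOneIwasawaInputAt W p) : BSDp W p :=
  ClassX4Gord.bsdp_rankOne_of_iwasawaInput_of_nonAnomalous hDel hGZK hmod hX hcm hp5 hr hIn
    ((reductionNonAnomalous_iff_of_three_dvd_semistabilityIndex W p hp5 hX.typeGOrd.typeG h3e hpn
      hn).mpr hres)

/-- **X3♯(G-ord) ∩ {II, IV, IV*, II*}, `p ≥ 5`, `r_an = 0`, `E` non-CM, residue `≠ 1`: MC EQUALITY at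
`T = 0` ⟹ `BSD(E,p)`** — exact. [cite: Delbourgo2002, Theorem (A), (B) (p. 40)] -/
theorem ClassX3Gord.bsdp_rankZero_of_cycChar_of_c₆Residue (hDel : Delbourgo2002.mainTheorem)
    (hGZK : rank_eq_analyticRank_of_analyticRank_le_one) (hmod : hasEntireLFunction_rat)
    (hX : ClassX3Gord W p) (hcm : ¬ W.HasCM) (hp5 : 5 ≤ p) (h3e : 3 ∣ semistabilityIndex W p)
    {n : ℤ} {v : ℕ} (hpn : ¬ (p : ℤ) ∣ n) (hn : W.c₆ = n * (-(p : ℚ)) ^ v)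
    (hres : ¬ ((((p - 1) / 2).choose ((p - 1) / 3) : ℕ) : ZMod p) *
      (-(n : ZMod p) / 864) ^ ((p - 1) / 6) = 1)
    (hr : W.analyticRank = 0) (hMC : CycCharLeadingTermAt W p) : BSDp W p :=
  ClassX3Gord.bsdp_rankZero_of_cycChar_of_nonAnomalous hDel hGZK hmod hX hcm hp5 hr hMC
    ((reductionNonAnomalous_iff_of_three_dvd_semistabilityIndex W p hp5 hX.typeGOrd.typeG h3e hpn
      hn).mpr hres)

/-- **X3♯(G-ord) ∩ {II, IV, IV*, II*}, `p ≥ 5`, `r_an = 1`, `E` non-CM, residue `≠ 1`: the Iwasawa-route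
residue ⟹ `BSD(E,p)`** — exact. [cite: Delbourgo2002, Theorem (A), (B) (p. 40)] -/
theorem ClassX3Gord.bsdp_rankOne_of_iwasawaInput_of_c₆Residue (hDel : Delbourgo2002.mainTheorem)
    (hGZK : rank_eq_analyticRank_of_analyticRank_le_one) (hmod : hasEntireLFunction_rat)
    (hX : ClassX3Gord W p) (hcm : ¬ W.HasCM) (hp5 : 5 ≤ p) (h3e : 3 ∣ semistabilityIndex W p)
    {n : ℤ} {v : ℕ} (hpn : ¬ (p : ℤ) ∣ n) (hn : W.c₆ = n * (-(p : ℚ)) ^ v)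
    (hres : ¬ ((((p - 1) / 2).choose ((p - 1) / 3) : ℕ) : ZMod p) *
      (-(n : ZMod p) / 864) ^ ((p - 1) / 6) = 1)
    (hr : W.analyticRank = 1) (hIn : RankOneIwasawaInputAt W p) : BSDp W p :=
  ClassX3Gord.bsdp_rankOne_of_iwasawaInput_of_nonAnomalous hDel hGZK hmod hX hcm hp5 hr hIn
    ((reductionNonAnomalous_iff_of_three_dvd_semistabilityIndex W p hp5 hX.typeGOrd.typeG h3e hpn
      hn).mpr hres)

/-! ### Defect `3`/`6` at `p = 7`: the proviso is `c₆/(−7)^v ≢ −1 (mod 7)` -/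

section Seven

variable [h7 : Fact (Nat.Prime 7)]

/-- **X4♯(G-ord) ∩ {II, IV, IV*, II*} at `p = 7`, `r_an = 0`, `E` non-CM, `c₆/(−7)^v ≢ −1 (mod 7)`: MC
EQUALITY at `T = 0` ⟹ `BSD(E,7)`** — exact (211/261 window rows). [cite: Delbourgo2002, Theorem (A), (B) (p. 40)] -/
theorem ClassX4Gord.bsdp_rankZero_of_cycChar_of_not_modEq_seven (hDel : Delbourgo2002.mainTheorem)
    (hGZK : rank_eq_analyticRank_of_analyticRank_le_one) (hmod : hasEntireLFunction_rat)
    (hX : ClassX4Gord W 7) (hcm : ¬ W.HasCM) (h3e : 3 ∣ semistabilityIndex W 7) {n : ℤ} {v : ℕ}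
    (hpn : ¬ (7 : ℤ) ∣ n) (hn : W.c₆ = n * (-(7 : ℚ)) ^ v) (hres : ¬ n ≡ -1 [ZMOD 7])
    (hr : W.analyticRank = 0) (hMC : CycCharLeadingTermAt W 7) : BSDp W 7 :=
  ClassX4Gord.bsdp_rankZero_of_cycChar_of_nonAnomalous hDel hGZK hmod hX hcm (by norm_num) hr hMC
    ((reductionNonAnomalous_seven_iff_of_three_dvd_semistabilityIndex W hX.typeGOrd.typeG h3e hpn
      hn).mpr hres)

/-- **X4♯(G-ord) ∩ {II, IV, IV*, II*} at `p = 7`, `r_an = 1`, `E` non-CM, `c₆/(−7)^v ≢ −1 (mod 7)`: the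
Iwasawa-route residue ⟹ `BSD(E,7)`** — exact. [cite: Delbourgo2002, Theorem (A), (B) (p. 40)] -/
theorem ClassX4Gord.bsdp_rankOne_of_iwasawaInput_of_not_modEq_seven (hDel : Delbourgo2002.mainTheorem)
    (hGZK : rank_eq_analyticRank_of_analyticRank_le_one) (hmod : hasEntireLFunction_rat)
    (hX : ClassX4Gord W 7) (hcm : ¬ W.HasCM) (h3e : 3 ∣ semistabilityIndex W 7) {n : ℤ} {v : ℕ}
    (hpn : ¬ (7 : ℤ) ∣ n) (hn : W.c₆ = n * (-(7 : ℚ)) ^ v) (hres : ¬ n ≡ -1 [ZMOD 7])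
    (hr : W.analyticRank = 1) (hIn : RankOneIwasawaInputAt W 7) : BSDp W 7 :=
  ClassX4Gord.bsdp_rankOne_of_iwasawaInput_of_nonAnomalous hDel hGZK hmod hX hcm (by norm_num) hr hIn
    ((reductionNonAnomalous_seven_iff_of_three_dvd_semistabilityIndex W hX.typeGOrd.typeG h3e hpn
      hn).mpr hres)

/-- **X3♯(G-ord) ∩ {II, IV, IV*, II*} at `p = 7`, `r_an = 0`, `E` non-CM, `c₆/(−7)^v ≢ −1 (mod 7)`: MC
EQUALITY at `T = 0` ⟹ `BSD(E,7)`** — exact. [cite: Delbourgo2002, Theorem (A), (B) (p. 40)] -/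
theorem ClassX3Gord.bsdp_rankZero_of_cycChar_of_not_modEq_seven (hDel : Delbourgo2002.mainTheorem)
    (hGZK : rank_eq_analyticRank_of_analyticRank_le_one) (hmod : hasEntireLFunction_rat)
    (hX : ClassX3Gord W 7) (hcm : ¬ W.HasCM) (h3e : 3 ∣ semistabilityIndex W 7) {n : ℤ} {v : ℕ}
    (hpn : ¬ (7 : ℤ) ∣ n) (hn : W.c₆ = n * (-(7 : ℚ)) ^ v) (hres : ¬ n ≡ -1 [ZMOD 7])
    (hr : W.analyticRank = 0) (hMC : CycCharLeadingTermAt W 7) : BSDp W 7 :=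
  ClassX3Gord.bsdp_rankZero_of_cycChar_of_nonAnomalous hDel hGZK hmod hX hcm (by norm_num) hr hMC
    ((reductionNonAnomalous_seven_iff_of_three_dvd_semistabilityIndex W hX.typeGOrd.typeG h3e hpn
      hn).mpr hres)

/-- **X3♯(G-ord) ∩ {II, IV, IV*, II*} at `p = 7`, `r_an = 1`, `E` non-CM, `c₆/(−7)^v ≢ −1 (mod 7)`: the
Iwasawa-route residue ⟹ `BSD(E,7)`** — exact. [cite: Delbourgo2002, Theorem (A), (B) (p. 40)] -/
theorem ClassX3Gord.bsdp_rankOne_of_iwasawaInput_of_not_modEq_seven (hDel : Delbourgo2002.mainTheorem)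
    (hGZK : rank_eq_analyticRank_of_analyticRank_le_one) (hmod : hasEntireLFunction_rat)
    (hX : ClassX3Gord W 7) (hcm : ¬ W.HasCM) (h3e : 3 ∣ semistabilityIndex W 7) {n : ℤ} {v : ℕ}
    (hpn : ¬ (7 : ℤ) ∣ n) (hn : W.c₆ = n * (-(7 : ℚ)) ^ v) (hres : ¬ n ≡ -1 [ZMOD 7])
    (hr : W.analyticRank = 1) (hIn : RankOneIwasawaInputAt W 7) : BSDp W 7 :=
  ClassX3Gord.bsdp_rankOne_of_iwasawaInput_of_nonAnomalous hDel hGZK hmod hX hcm (by norm_num) hr hIn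
    ((reductionNonAnomalous_seven_iff_of_three_dvd_semistabilityIndex W hX.typeGOrd.typeG h3e hpn
      hn).mpr hres)

end Seven

end Summit.BirchSwinnertonDyer.Rank1Residual.Additive

end
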